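import Literature.Probability.RandomPlanarGeometry.SLETraceMeasurable
import Literature.Probability.RandomPlanarGeometry.SLEAdaptedProofs
import Literature.Probability.RandomPlanarGeometry.LoewnerBoundaryExtension
import HarnessLib

/-!
# Measurability of the inverse Loewner map and of the "access gap" test

Trunk T-STOCH. Measure-theoretic plumbing for the Markov-property step in the proof of
transience of the SLE trace for `4 < κ < 8` (Rohde–Schramm (2005), Lemma 7.3, p. 910: "by
Theorem 6.4 and the Markov property we conclude that `K_{t+t₀}` contains some interval `[0, δ]`
with positive probability"). To condition on the past at a (rational) time `t` we need events
of the past σ-algebra `σ(W_u, u ≤ t)` describing where the real "accesses" of `0` — the real zeros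
of the boundary extension `f̄ₜ` of `fₜ = gₜ⁻¹` (`Loewner.bdryInv`) — lie relative to `Wₜ`.

* `Loewner.measurable_loewnerInv` (**proved**): for a family of continuous driving paths whose
  values at times `≤ t` are measurable, `ω ↦ fₜ^{W(ω)}(w)` is measurable (Bernstein approximation
  through finitely many path values, as in `SLETraceMeasurable`, with the Grönwall stability of
  `W ↦ fₜ^W(w)` at a fixed point, `Loewner.norm_loewnerInv_sub_loewnerInv_le_of_driving` of
  `SLETraceEight`).
* `Loewner.accessGapTest` (definition): a countable test, in terms of the values of `fₜ` at the
  points `v + i/(m+1)`, `v ∈ ℚ`, expressing that `f̄ₜ` has no real zero `v` with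
  `v - Wₜ ∉ [a, b]`; `Loewner.IsGeneratedByCurve.accessGapTest_iff` (**proved**) identifies it,
  for chains generated by a curve, with `∀ v : ℝ, f̄ₜ(v) = 0 → v - Wₜ ∈ [a, b]`, and
  `Loewner.measurableSet_accessGapTest` (**proved**) shows it is an event of the past.
* SLE instances with respect to the Brownian filtration: `measurable_loewnerInv_sleDriving_of_le`,
  `measurableSet_accessGapTest_sle`.

## References

* S. Rohde, O. Schramm, *Basic properties of SLE*, Ann. of Math. 161 (2005), §3 p. 896
  (measurability of `f̂ₛ` with respect to `σ(ξ(u), u ≤ s)`), Lemma 7.3 (p. 910).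
* G. F. Lawler, *Conformally Invariant Processes in the Plane*, AMS (2005), Ch. 4 §4.1.
-/

noncomputable section

open Set Filter Topology MeasureTheory Metric Complex
open UpperHalfPlane (upperHalfPlaneSet isOpen_upperHalfPlaneSet)
open scoped NNReal ENNReal

namespace Literature.Probability.RandomPlanarGeometry

namespace Loewner

/-! ### Continuity in the Bernstein nodes -/

/-- `v ↦ fₜ^{B_N v}(w)` (Bernstein driver with node values `v`) is Lipschitz, hence continuous.
[folklore] -/
theorem continuous_loewnerInv_bernDriverFun (N : ℕ) (t : ℝ≥0) {w : ℂ} (hw : 0 < w.im) :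
    Continuous fun v : Fin (N + 1) → ℝ ↦ loewnerInv (bernDriverFun N t v) t w := by
  refine (LipschitzWith.of_dist_le_mul (K := ⟨Real.exp (8 / w.im ^ 2 * t), by positivity⟩)
    fun v v' ↦ ?_).continuous
  rw [dist_eq_norm, dist_eq_norm]
  exact norm_loewnerInv_sub_loewnerInv_le_of_driving (continuous_bernDriverFun N t v)
    (continuous_bernDriverFun N t v') t hw le_rfl fun u _ ↦ abs_bernDriverFun_sub_le N t v v' u

/-- The Bernstein nodes `tk/N` lie in `[0, t]`. [folklore] -/
theorem bernNode_le (N : ℕ) (t : ℝ≥0) (k : Fin (N + 1)) :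
    ((t : ℝ) * ((k : ℕ) / N : ℝ)).toNNReal ≤ t := by
  rw [Real.toNNReal_le_iff_le_coe]
  refine mul_le_of_le_one_right t.coe_nonneg (div_le_one_of_le₀ ?_ (Nat.cast_nonneg N))
  exact_mod_cast Nat.lt_succ_iff.1 k.isLt

/-- The test points `v + i/(m+1)` lie in `ℍ`. [folklore] -/
theorem im_testPoint_pos (v : ℝ) (m : ℕ) : 0 < ((v : ℂ) + I * ((1 : ℝ) / ((m : ℝ) + 1) : ℝ)).im := by
  simp only [add_im, ofReal_im, mul_im, I_re, I_im, ofReal_re, zero_mul, one_mul, zero_add]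
  positivity

/-! ### Measurability of `ω ↦ fₜ^{W(ω)}(w)` from the path values up to time `t` -/

section Measurable

variable {Ω : Type*} {mΩ : MeasurableSpace Ω} {X : Ω → ℝ≥0 → ℝ} {t : ℝ≥0}

/-- **`ω ↦ fₜ^{W(ω)}(w)` is measurable with respect to any σ-algebra making the path values at
times `≤ t` measurable** (continuous paths, `w ∈ ℍ`): it is the everywhere limit of continuous
functions of finitely many such values (Bernstein drivers; `norm_loewnerInv_sub_loewnerInv_le_of_driving`
and Mathlib `bernsteinApproximation_uniform`). Rohde–Schramm (2005), §3 p. 896 ("`f̂ₛ` is measurable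
with respect to `σ(ξ(u), u ≤ s)`"). [cite: RohdeSchramm2005, §3 p. 896] -/
theorem measurable_loewnerInv (hc : ∀ ω, Continuous (X ω))
    (hmeas : ∀ s, s ≤ t → Measurable fun ω ↦ X ω s) {w : ℂ} (hw : 0 < w.im) :
    Measurable fun ω ↦ loewnerInv (X ω) t w := by
  have happrox : ∀ N : ℕ, Measurable fun ω ↦
      loewnerInv (bernDriverFun N t (bernNodes N t (X ω))) t w := fun N ↦ by
    have hv : Measurable fun ω ↦ bernNodes N t (X ω) :=
      measurable_pi_lambda _ fun k ↦ hmeas _ (bernNode_le N t k)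
    exact (continuous_loewnerInv_bernDriverFun N t hw).measurable.comp hv
  refine measurable_of_tendsto_metrizable happrox (tendsto_pi_nhds.2 fun ω ↦ ?_)
  have hUc : Continuous (X ω) := hc ω
  rw [tendsto_iff_norm_sub_tendsto_zero]
  have hbern := bernsteinApproximation_uniform (rescaleDriver (X ω) hUc t)
  rw [tendsto_iff_norm_sub_tendsto_zero] at hbern
  refine squeeze_zero (fun N ↦ norm_nonneg _) (fun N ↦ norm_loewnerInv_sub_loewnerInv_le_of_driving
    (continuous_bernDriverFun N t _) hUc t hw le_rfl
    fun u hu ↦ abs_bernDriverFun_bernNodes_sub_le hUc N t hu) ?_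
  simpa using hbern.const_mul (Real.exp (8 / w.im ^ 2 * t))

/-- The functional `ω ↦ liminfₘ ‖fₜ(v + i/(m+1))‖` (which equals `‖f̄ₜ(v)‖` when the chain is
generated by a curve, `IsGeneratedByCurve.liminf_norm_loewnerInv_eq`) is measurable from the
path up to time `t`. [folklore] -/
theorem measurable_liminf_norm_loewnerInv (hc : ∀ ω, Continuous (X ω))
    (hmeas : ∀ s, s ≤ t → Measurable fun ω ↦ X ω s) (v : ℝ) :
    Measurable fun ω ↦ liminf (fun m : ℕ ↦
      ‖loewnerInv (X ω) t ((v : ℂ) + I * ((1 : ℝ) / ((m : ℝ) + 1) : ℝ))‖) atTop :=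
  Measurable.liminf fun m ↦ (measurable_loewnerInv hc hmeas (im_testPoint_pos v m)).norm

end Measurable

/-! ### The access gap test -/

/-- **The access gap test.** For a driving function `W`, a time `t` and reals `a, b`: for every
`n` there is `k` such that `liminfₘ ‖fₜ(v + i/(m+1))‖ > 1/(k+1)` for all rationals `v` in
`[-n, Wₜ + a - 1/(n+1)] ∪ [Wₜ + b + 1/(n+1), n]`. For a chain generated by a curve this says
exactly that every real zero `v` of the boundary extension `f̄ₜ` of `fₜ = gₜ⁻¹` — every "access"
of the boundary point `0` of `Hₜ`, when `γ` starts at `W 0 = 0` — satisfies `v - Wₜ ∈ [a, b]`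
(`IsGeneratedByCurve.accessGapTest_iff`); in this countable form it is visibly an event of the
past `σ(W_u, u ≤ t)` (`measurableSet_accessGapTest`). Used to condition on the position of the
accesses of `0` in the Markov-property step of Rohde–Schramm (2005), Lemma 7.3.
[cite: RohdeSchramm2005, Lemma 7.3] -/
def accessGapTest (W : ℝ≥0 → ℝ) (t : ℝ≥0) (a b : ℝ) : Prop :=
  ∀ n : ℕ, ∃ k : ℕ, ∀ v : ℚ,
    ((-(n : ℝ) ≤ v ∧ (v : ℝ) ≤ W t + a - 1 / ((n : ℝ) + 1)) ∨
      (W t + b + 1 / ((n : ℝ) + 1) ≤ v ∧ (v : ℝ) ≤ n)) →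
    1 / ((k : ℝ) + 1) < liminf (fun m : ℕ ↦
      ‖loewnerInv W t (((v : ℝ) : ℂ) + I * ((1 : ℝ) / ((m : ℝ) + 1) : ℝ))‖) atTop

section Test

variable {W : ℝ≥0 → ℝ} {γ : ℝ≥0 → ℂ}

/-- For a chain generated by a curve, `liminfₘ ‖fₜ(v + i/(m+1))‖ = ‖f̄ₜ(v)‖` (indeed a limit:
`f̄ₜ` is the continuous extension of `fₜ`, `IsGeneratedByCurve.tendsto_bdryInv`). [folklore] -/
theorem IsGeneratedByCurve.liminf_norm_loewnerInv_eq (hγ : IsGeneratedByCurve W γ)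
    (hW : Continuous W) (t : ℝ≥0) (v : ℝ) :
    liminf (fun m : ℕ ↦ ‖loewnerInv W t ((v : ℂ) + I * ((1 : ℝ) / ((m : ℝ) + 1) : ℝ))‖) atTop =
      ‖bdryInv W t v‖ := by
  refine Tendsto.liminf_eq ?_
  refine ((continuous_norm.tendsto _).comp (hγ.tendsto_bdryInv hW t (by simp))).comp ?_
  refine tendsto_nhdsWithin_iff.2 ⟨?_, Eventually.of_forall fun m ↦ ?_⟩
  · have h1 : Tendsto (fun m : ℕ ↦ (1 : ℝ) / ((m : ℝ) + 1)) atTop (𝓝 0) :=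
      tendsto_one_div_add_atTop_nhds_zero_nat
    have h2 : Tendsto (fun m : ℕ ↦ (v : ℂ) + I * ((1 : ℝ) / ((m : ℝ) + 1) : ℝ)) atTop
        (𝓝 ((v : ℂ) + I * ((0 : ℝ) : ℂ))) :=
      tendsto_const_nhds.add (tendsto_const_nhds.mul (continuous_ofReal.continuousAt.tendsto.comp h1))
    simpa using h2
  · exact im_testPoint_pos v m

/-- **The access gap test says that all real zeros of `f̄ₜ` lie in `Wₜ + [a, b]`** (chains
generated by a curve). (→) A zero `v` with, say, `v < Wₜ + a` is approximated by rationals of the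
test range, along which `‖f̄ₜ‖ > 1/(k+1)`, contradicting the continuity of `f̄ₜ` on `ℝ`. (←) On the
compact test range `‖f̄ₜ‖` is continuous and positive, hence `> 1/(k+1)` for some `k`.
[cite: RohdeSchramm2005, Lemma 7.3] -/
theorem IsGeneratedByCurve.accessGapTest_iff (hγ : IsGeneratedByCurve W γ) (hW : Continuous W)
    (t : ℝ≥0) (a b : ℝ) :
    accessGapTest W t a b ↔ ∀ v : ℝ, bdryInv W t v = 0 → v - W t ∈ Icc a b := by
  -- the continuous function `v ↦ f̄ₜ(v)` on `ℝ`
  set F : ℝ → ℂ := fun v ↦ bdryInv W t v with hF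
  have hFc : Continuous F := by
    refine (hγ.continuousOn_bdryInv hW t).comp_continuous continuous_ofReal fun v ↦ ?_
    simp
  have hlim : ∀ v : ℝ, liminf (fun m : ℕ ↦
      ‖loewnerInv W t ((v : ℂ) + I * ((1 : ℝ) / ((m : ℝ) + 1) : ℝ))‖) atTop = ‖F v‖ :=
    fun v ↦ hγ.liminf_norm_loewnerInv_eq hW t v
  constructor
  · intro htest v hv
    by_contra hout
    have hFv : F v = 0 := hv
    rw [mem_Icc, not_and_or, not_le, not_le] at hout
    -- distance from `v` to the complement of the test ranges
    set d : ℝ := if v - W t < a then W t + a - v else v - (W t + b) with hd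
    have hdpos : 0 < d := by
      rw [hd]; split_ifs with h
      · linarith
      · rcases hout with h' | h'
        · exact absurd h' h
        · linarith
    obtain ⟨n, hn⟩ := exists_nat_gt (max (|v| + 1) (2 / d))
    have hn1 : |v| + 1 < n := (le_max_left _ _).trans_lt hn
    have hn2 : 2 / d < n := (le_max_right _ _).trans_lt hn
    have hnd : 1 / ((n : ℝ) + 1) < d / 2 := by
      rw [div_lt_iff₀ hdpos] at hn2
      rw [div_lt_iff₀ (by positivity)]
      nlinarith
    obtain ⟨k, hk⟩ := htest n
    -- continuity of `F` at `v`: `‖F‖ < 1/(k+1)` near `v`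
    have hcont := Metric.continuous_iff.1 hFc v (1 / ((k : ℝ) + 1)) (by positivity)
    obtain ⟨δ, hδ, hδF⟩ := hcont
    -- a rational `q` close to `v`, inside the test range
    set ρ : ℝ := min δ (min (d / 2) 1) with hρ
    have hρpos : 0 < ρ := lt_min hδ (lt_min (half_pos hdpos) one_pos)
    obtain ⟨q, hq1, hq2⟩ := exists_rat_btwn (show v - ρ < v by linarith)
    have hqv : |(q : ℝ) - v| < ρ := by
      rw [abs_lt]; constructor <;> linarith
    have hqδ : dist (q : ℝ) v < δ := lt_of_lt_of_le hqv (min_le_left _ _)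
    have hqd : |(q : ℝ) - v| < d / 2 :=
      lt_of_lt_of_le hqv ((min_le_right _ _).trans (min_le_left _ _))
    have hq1' : |(q : ℝ) - v| < 1 :=
      lt_of_lt_of_le hqv ((min_le_right _ _).trans (min_le_right _ _))
    have hrange : (-(n : ℝ) ≤ q ∧ (q : ℝ) ≤ W t + a - 1 / ((n : ℝ) + 1)) ∨
        (W t + b + 1 / ((n : ℝ) + 1) ≤ q ∧ (q : ℝ) ≤ n) := by
      have hv1 : -(n : ℝ) < v - 1 := by
        have := neg_abs_le v; linarith
      have hv2 : v + 1 < n := by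
        have := le_abs_self v; linarith
      rw [abs_lt] at hqd hq1'
      by_cases h : v - W t < a
      · left
        have hd' : d = W t + a - v := by rw [hd, if_pos h]
        rw [hd'] at hqd hnd
        constructor <;> linarith
      · right
        have hd' : d = v - (W t + b) := by rw [hd, if_neg h]
        rw [hd'] at hqd hnd
        constructor <;> linarith
    have h1 := hk q hrange
    rw [hlim] at h1
    have h2 := hδF q hqδ
    rw [dist_eq_norm, hFv, sub_zero] at h2
    exact lt_asymm h1 h2
  · intro hzero n
    -- the compact test range
    set Kn : Set ℝ := Icc (-(n : ℝ)) (W t + a - 1 / ((n : ℝ) + 1)) ∪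
      Icc (W t + b + 1 / ((n : ℝ) + 1)) n with hKn
    have hKc : IsCompact Kn := isCompact_Icc.union isCompact_Icc
    have hpos : ∀ x ∈ Kn, 0 < ‖F x‖ := by
      intro x hx
      refine norm_pos_iff.2 fun hx0 ↦ ?_
      have hmem := hzero x hx0
      rw [mem_Icc] at hmem
      have hn0 : (0 : ℝ) < 1 / ((n : ℝ) + 1) := by positivity
      rcases hx with hx | hx
      · rw [mem_Icc] at hx; linarith
      · rw [mem_Icc] at hx; linarith
    rcases Kn.eq_empty_or_nonempty with hemp | hne
    · refine ⟨0, fun v hv ↦ ?_⟩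
      have : (v : ℝ) ∈ Kn := by
        rcases hv with hv | hv
        · exact Or.inl ⟨hv.1, hv.2⟩
        · exact Or.inr ⟨hv.1, hv.2⟩
      rw [hemp] at this
      exact absurd this (notMem_empty _)
    · obtain ⟨x₀, hx₀, hmin⟩ := hKc.exists_isMinOn hne (hFc.norm.continuousOn)
      obtain ⟨k, hk⟩ := exists_nat_one_div_lt (hpos x₀ hx₀)
      refine ⟨k, fun v hv ↦ ?_⟩
      have hvK : (v : ℝ) ∈ Kn := by
        rcases hv with hv | hv
        · exact Or.inl ⟨hv.1, hv.2⟩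
        · exact Or.inr ⟨hv.1, hv.2⟩
      rw [hlim]
      exact hk.trans_le (hmin hvK)

end Test

/-! ### The access gap test is an event of the past -/

section MeasurableTest

variable {Ω : Type*} {mΩ : MeasurableSpace Ω} {X : Ω → ℝ≥0 → ℝ} {t : ℝ≥0}

/-- **The access gap test is measurable from the path up to time `t`** (continuous paths whose
values at times `≤ t` are measurable): a countable combination of the events
`{v ≤ Wₜ + a - 1/(n+1)}`, `{Wₜ + b + 1/(n+1) ≤ v}` and `{1/(k+1) < liminfₘ ‖fₜ(v + i/(m+1))‖}`
(`measurable_liminf_norm_loewnerInv`). [cite: RohdeSchramm2005, §3 p. 896] -/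
theorem measurableSet_accessGapTest (hc : ∀ ω, Continuous (X ω))
    (hmeas : ∀ s, s ≤ t → Measurable fun ω ↦ X ω s) (a b : ℝ) :
    MeasurableSet {ω | accessGapTest (X ω) t a b} := by
  have hWt : Measurable fun ω ↦ X ω t := hmeas t le_rfl
  simp only [accessGapTest, setOf_forall, setOf_exists]
  refine MeasurableSet.iInter fun n ↦ MeasurableSet.iUnion fun k ↦
    MeasurableSet.iInter fun v ↦ ?_
  simp only [imp_iff_not_or, setOf_or]
  refine MeasurableSet.union (MeasurableSet.compl ?_) ?_
  · change MeasurableSet {ω | (-(n : ℝ) ≤ v ∧ (v : ℝ) ≤ X ω t + a - 1 / ((n : ℝ) + 1)) ∨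
      (X ω t + b + 1 / ((n : ℝ) + 1) ≤ v ∧ (v : ℝ) ≤ n)}
    simp only [setOf_or, setOf_and]
    refine MeasurableSet.union (MeasurableSet.inter ?_ ?_) (MeasurableSet.inter ?_ ?_)
    · exact measurableSet_le measurable_const measurable_const
    · exact measurableSet_le measurable_const ((hWt.add_const _).sub_const _)
    · exact measurableSet_le ((hWt.add_const _).add_const _) measurable_const
    · exact measurableSet_le measurable_const measurable_const
  · exact measurableSet_lt measurable_const (measurable_liminf_norm_loewnerInv hc hmeas v)

end MeasurableTest

end Loewner

/-! ### SLE instances with respect to the Brownian filtration -/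

section SLE

variable (κ : ℝ≥0)

/-- **`ω ↦ fₜ(w)[√κ B(ω)]` is `𝓕ₜ`-measurable** (`𝓕` the natural filtration of the Brownian
motion; `w ∈ ℍ`). Rohde–Schramm (2005), §3 p. 896. [cite: RohdeSchramm2005, §3 p. 896] -/
theorem measurable_loewnerInv_sleDriving_of_le (t : ℝ≥0) {w : ℂ} (hw : 0 < w.im) :
    Measurable[brownianFiltration t] fun ω ↦ Loewner.loewnerInv (sleDriving κ ω) t w :=
  Loewner.measurable_loewnerInv (mΩ := brownianFiltration t) (X := fun ω ↦ sleDriving κ ω)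
    (t := t) (fun ω ↦ continuous_sleDriving κ ω) (fun _ hs ↦ measurable_sleDriving_of_le κ hs) hw

/-- `ω ↦ fₜ(w)[√κ B(ω)]` is measurable. [cite: RohdeSchramm2005, §3 p. 896] -/
theorem measurable_loewnerInv_sleDriving (t : ℝ≥0) {w : ℂ} (hw : 0 < w.im) :
    Measurable fun ω ↦ Loewner.loewnerInv (sleDriving κ ω) t w :=
  (measurable_loewnerInv_sleDriving_of_le κ t hw).mono (brownianFiltration.le t) le_rfl

/-- **The access gap test of SLE_κ at time `t` is an `𝓕ₜ`-event.**
[cite: RohdeSchramm2005, Lemma 7.3] -/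
theorem measurableSet_accessGapTest_sle (t : ℝ≥0) (a b : ℝ) :
    MeasurableSet[brownianFiltration t] {ω | Loewner.accessGapTest (sleDriving κ ω) t a b} :=
  Loewner.measurableSet_accessGapTest (mΩ := brownianFiltration t) (X := fun ω ↦ sleDriving κ ω)
    (t := t) (fun ω ↦ continuous_sleDriving κ ω) (fun _ hs ↦ measurable_sleDriving_of_le κ hs) a b

end SLE

end Literature.Probability.RandomPlanarGeometry
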